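import Literature.Probability.RandomPlanarGeometry.SAWPulledLargeForceExpansionZdLinearRadius
import Literature.Probability.RandomPlanarGeometry.SAWPulledLargeForceExpansionZdMonic
import Mathlib.Algebra.Group.ForwardDiff
import HarnessLib

/-!
# The large-force coefficients `c_k^{(d)}` on `ℤ^{d+1}`: the Newton main term and an EXPLICIT dimension threshold for the sign law

Topic `Literature/Probability/RandomPlanarGeometry` (a corollary leaf over `SAWPulledLargeForceExpansionZdMonic.lean` —
`exists_int_polynomial_largeForceCoeffZd_monic`: `c_k^{(d)} = S_k(2d)`, `S_k ∈ ℤ[X]` of degree `k − 1` with leading coefficient `(−1)^{k−1}`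
(`k ≥ 2`) — and `SAWPulledLargeForceExpansionZdLinearRadius.lean` — `abs_largeForceCoeffZd_le_linear : |c_k^{(d)}| ≤ 3^{k+1}(320(2d+1))^k`;
Mathlib's Gregory–Newton formula `shift_eq_sum_fwdDiff_iter` and `Polynomial.fwdDiff_iter_degree_eq_factorial`).

Gregory–Newton in the dimension: `d ↦ c_k^{(d)}` is a polynomial of degree `k − 1` with leading coefficient `(−1)^{k−1}2^{k−1}`, hence for every `d`

  `c_k^{(d)} = Σ_{u<k} C(d,u)·Δ^u c_k^{(·)}(0)`,  `Δ^{k−1} c_k^{(·)}(0) = (−1)^{k−1} 2^{k−1} (k−1)!`,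

and the lower differences are alternating sums of the values `c_k^{(j)}`, `j ≤ k − 2`, which the linear-radius file bounds:
`|Δ^u c_k^{(·)}(0)| ≤ 2^u · 3^{k+1}(320(2k−3))^k` (`u ≤ k − 2`).  Consequences (all `k ≥ 2`, every `d`):

* ★★ `abs_largeForceCoeffZd_sub_newton_le : |c_k^{(d)} − (−1)^{k−1}2^{k−1}(k−1)!·C(d,k−1)| ≤ (k−1)·3^{k+1}(320(2k−3))^k·(2d+1)^{k−2}` —
  the NEWTON MAIN TERM of `c_k^{(d)}` with an explicit error;
* ★★ **`sign_largeForceCoeffZd_of_le : 2^{k−1}·k·3^{k+1}·(320(2k−3))^k ≤ d → 0 < (−1)^{k−1}·c_k^{(d)}`** — an EXPLICIT dimension threshold for the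
  sign law `sgn c_k^{(d)} = (−1)^{k−1}` (the eventual form is `SAWPulledLargeForceExpansionZdEventualSign`; the lane's census shows the law for
  every `d ≥ 2`, `k ≤ 12`, which remains open as an all-`d` statement); `mul_largeForceCoeffZd_succ_neg_of_le` — explicit alternation
  `c_k^{(d)}·c_{k+1}^{(d)} < 0` beyond both thresholds.

Printed status: first order is Janse van Rensburg–Whittington (2013, §3.2 Theorem 8); the rest is the lane's.  Provenance: lane «pcv-sawmu», a-p3 g26
(2026-08-28).  PURE STD, no data, no `decide`.
-/

noncomputable section

open Finset Filter Topology Polynomial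
open scoped BigOperators fwdDiff
open Literature.Probability.RandomPlanarGeometry.SAW

namespace Literature.Probability.RandomPlanarGeometry.SAW.Zd

/-- **The real interpolating polynomial in the dimension**: for `k ≥ 2` there is `R ∈ ℝ[X]` with `natDegree R = k − 1`, leading coefficient
`(−1)^{k−1} 2^{k−1}` and `R(d) = c_k^{(d)}` for every `d ∈ ℕ` (`R(x) = S_k(2x)`). [cite: JansevanRensburgWhittington2013, §3.2 Theorem 8 (arXiv v4 p. 11)] -/
theorem exists_real_polynomial_largeForceCoeffZd {k : ℕ} (hk : 2 ≤ k) :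
    ∃ R : Polynomial ℝ, R.natDegree = k - 1 ∧ R.leadingCoeff = (-1) ^ (k - 1) * 2 ^ (k - 1) ∧
      ∀ d : ℕ, ((largeForceCoeffZd d k : ℤ) : ℝ) = R.eval (d : ℝ) := by
  obtain ⟨S, hdeg, hlc, -, hS⟩ := exists_int_polynomial_largeForceCoeffZd_monic hk
  have hk1 : k - 1 ≠ 0 := by omega
  set P : Polynomial ℝ := S.map (Int.castRingHom ℝ) with hP
  have hPdeg : P.natDegree = k - 1 := by rw [hP, Polynomial.natDegree_map_eq_of_injective Int.cast_injective, hdeg]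
  have hPlc : P.leadingCoeff = (-1) ^ (k - 1) := by
    rw [hP, Polynomial.leadingCoeff_map_of_injective Int.cast_injective, hlc, map_pow, map_neg, map_one]
  have hq1 : (Polynomial.C (2 : ℝ) * Polynomial.X).natDegree = 1 := Polynomial.natDegree_C_mul_X 2 two_ne_zero
  refine ⟨P.comp (Polynomial.C 2 * Polynomial.X), ?_, ?_, fun d => ?_⟩
  · rw [Polynomial.natDegree_comp, hq1, mul_one, hPdeg]
  · rw [Polynomial.leadingCoeff_comp (by rw [hq1]; exact one_ne_zero), hPlc, hPdeg, Polynomial.leadingCoeff_C_mul_X]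
  · rw [Polynomial.eval_comp, Polynomial.eval_mul, Polynomial.eval_C, Polynomial.eval_X, hS d, hP,
      show (2 * (d : ℝ)) = ((2 * (d : ℤ) : ℤ) : ℝ) by push_cast; ring, Polynomial.eval_intCast_map, Int.cast_id, eq_intCast]

/-- An alternating binomial sum is bounded by `2ⁿ` times a bound on the terms. [folklore] -/
private theorem abs_fwdDiff_iter_le {f : ℝ → ℝ} {n : ℕ} {B : ℝ} (hB : ∀ j : ℕ, j ≤ n → |f j| ≤ B) :
    |(fwdDiff (1 : ℝ))^[n] f 0| ≤ 2 ^ n * B := by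
  have hB0 : 0 ≤ B := (abs_nonneg _).trans (hB 0 (Nat.zero_le n))
  rw [fwdDiff_iter_eq_sum_shift]
  calc |∑ j ∈ range (n + 1), ((-1 : ℤ) ^ (n - j) * (n.choose j : ℤ)) • f (0 + j • (1 : ℝ))|
      ≤ ∑ j ∈ range (n + 1), |((-1 : ℤ) ^ (n - j) * (n.choose j : ℤ)) • f (0 + j • (1 : ℝ))| := Finset.abs_sum_le_sum_abs _ _
    _ ≤ ∑ j ∈ range (n + 1), (n.choose j : ℝ) * B := by
        refine Finset.sum_le_sum fun j hj => ?_
        have hjn : j ≤ n := Nat.lt_succ_iff.1 (Finset.mem_range.1 hj)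
        rw [zsmul_eq_mul, abs_mul, show (0 : ℝ) + j • (1 : ℝ) = (j : ℝ) by simp]
        have h1 : |(((-1 : ℤ) ^ (n - j) * (n.choose j : ℤ) : ℤ) : ℝ)| = (n.choose j : ℝ) := by
          push_cast; rw [abs_mul, abs_pow, abs_neg, abs_one, one_pow, one_mul, Nat.abs_cast]
        rw [h1]
        exact mul_le_mul_of_nonneg_left (hB j hjn) (Nat.cast_nonneg _)
    _ = 2 ^ n * B := by
        rw [← Finset.sum_mul]
        congr 1
        exact_mod_cast Nat.sum_range_choose n

/-- ★★ **THE NEWTON MAIN TERM**: for every `k ≥ 2` and every `d`,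
`|c_k^{(d)} − (−1)^{k−1} 2^{k−1} (k−1)!·C(d,k−1)| ≤ (k−1)·3^{k+1}·(320(2k−3))^k·(2d+1)^{k−2}` (Gregory–Newton in `d`; the lower forward differences
are alternating sums of `c_k^{(j)}`, `j ≤ k−2`, bounded by the linear-radius coefficient bound). [cite: JansevanRensburgWhittington2013, §3.2 Theorem 8 (arXiv v4 p. 11)] -/
theorem abs_largeForceCoeffZd_sub_newton_le {k : ℕ} (hk : 2 ≤ k) (d : ℕ) :
    |((largeForceCoeffZd d k : ℤ) : ℝ) - (-1) ^ (k - 1) * 2 ^ (k - 1) * ((k - 1).factorial : ℝ) * (d.choose (k - 1) : ℝ)|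
      ≤ ((k - 1 : ℕ) : ℝ) * (3 ^ (k + 1) * (320 * (2 * ((k - 2 : ℕ) : ℝ) + 1)) ^ k) * (2 * (d : ℝ) + 1) ^ (k - 2) := by
  obtain ⟨R, hdeg, hlc, hR⟩ := exists_real_polynomial_largeForceCoeffZd hk
  set f : ℝ → ℝ := fun x => R.eval x with hf
  set M : ℝ := 3 ^ (k + 1) * (320 * (2 * ((k - 2 : ℕ) : ℝ) + 1)) ^ k with hM
  have hM0 : 0 ≤ M := by positivity
  -- Gregory–Newton at `0` with step `1` and `d` steps
  have hGN : f (d : ℝ) = ∑ u ∈ range (d + 1), (d.choose u : ℝ) * (fwdDiff (1 : ℝ))^[u] f 0 := by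
    have h := shift_eq_sum_fwdDiff_iter (h := (1 : ℝ)) f d 0
    simpa [nsmul_eq_mul] using h
  -- the differences of order `≥ k` vanish, the one of order `k − 1` is the leading term
  have hzero : ∀ u, k ≤ u → (fwdDiff (1 : ℝ))^[u] f 0 = 0 := by
    intro u hu
    have := Polynomial.fwdDiff_iter_eq_zero_of_degree_lt (P := R) (n := u) (by rw [hdeg]; omega)
    exact congrFun this 0
  have htop : (fwdDiff (1 : ℝ))^[k - 1] f 0 = (-1) ^ (k - 1) * 2 ^ (k - 1) * ((k - 1).factorial : ℝ) := by
    have := congrFun (Polynomial.fwdDiff_iter_degree_eq_factorial R) 0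
    rw [hdeg, hlc] at this
    rw [hf, this]
    simp
  -- the lower differences are bounded
  have hlow : ∀ u, u ≤ k - 2 → |(fwdDiff (1 : ℝ))^[u] f 0| ≤ 2 ^ u * M := by
    intro u hu
    refine abs_fwdDiff_iter_le fun j hj => ?_
    rw [hf]
    dsimp only
    rw [← hR j]
    refine (abs_largeForceCoeffZd_le_linear j k).trans ?_
    rw [hM]
    have hj2 : (2 * (j : ℝ) + 1) ≤ 2 * ((k - 2 : ℕ) : ℝ) + 1 := by
      have : (j : ℝ) ≤ ((k - 2 : ℕ) : ℝ) := by exact_mod_cast (hj.trans hu)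
      linarith
    exact mul_le_mul_of_nonneg_left (pow_le_pow_left₀ (by positivity) (by linarith) k) (by positivity)
  -- rewrite `c_k^{(d)}` as the sum over `u < k` (terms `u ≥ k` vanish; terms `u > d` have `C(d,u) = 0`)
  have hsum : ((largeForceCoeffZd d k : ℤ) : ℝ) = ∑ u ∈ range k, (d.choose u : ℝ) * (fwdDiff (1 : ℝ))^[u] f 0 := by
    rw [hR d, show R.eval (d : ℝ) = f d from rfl, hGN]
    rcases le_or_gt k (d + 1) with hkd | hkd
    · -- range (d+1) ⊇ range k; extra terms vanish by `hzero`
      have hsplit := Finset.sum_range_add_sum_Ico (fun u => (d.choose u : ℝ) * (fwdDiff (1 : ℝ))^[u] f 0) hkd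
      rw [← hsplit, add_eq_left]
      exact Finset.sum_eq_zero fun u hu => by rw [hzero u (Finset.mem_Ico.1 hu).1, mul_zero]
    · -- range k ⊇ range (d+1); extra terms have `C(d,u) = 0`
      have hsplit := Finset.sum_range_add_sum_Ico (fun u => (d.choose u : ℝ) * (fwdDiff (1 : ℝ))^[u] f 0) hkd.le
      rw [← hsplit, eq_comm, add_eq_left]
      exact Finset.sum_eq_zero fun u hu => by
        rw [Nat.choose_eq_zero_of_lt (by have := (Finset.mem_Ico.1 hu).1; omega), Nat.cast_zero, zero_mul]
  -- split off the top term `u = k − 1`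
  have hk1 : k = (k - 1) + 1 := by omega
  rw [hsum, hk1, Finset.sum_range_succ, ← hk1, htop]
  have hrest : |∑ u ∈ range (k - 1), (d.choose u : ℝ) * (fwdDiff (1 : ℝ))^[u] f 0| ≤ ((k - 1 : ℕ) : ℝ) * M * (2 * (d : ℝ) + 1) ^ (k - 2) := by
    calc |∑ u ∈ range (k - 1), (d.choose u : ℝ) * (fwdDiff (1 : ℝ))^[u] f 0|
        ≤ ∑ u ∈ range (k - 1), |(d.choose u : ℝ) * (fwdDiff (1 : ℝ))^[u] f 0| := Finset.abs_sum_le_sum_abs _ _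
      _ ≤ ∑ _u ∈ range (k - 1), M * (2 * (d : ℝ) + 1) ^ (k - 2) := by
          refine Finset.sum_le_sum fun u hu => ?_
          have huk : u ≤ k - 2 := by have := Finset.mem_range.1 hu; omega
          rw [abs_mul, Nat.abs_cast]
          have hc : (d.choose u : ℝ) ≤ (d : ℝ) ^ u := by
            have h1 := Nat.choose_le_pow_div (α := ℝ) u d
            exact h1.trans (div_le_self (by positivity) (by exact_mod_cast Nat.one_le_iff_ne_zero.2 (Nat.factorial_ne_zero u)))
          calc (d.choose u : ℝ) * |(fwdDiff (1 : ℝ))^[u] f 0| ≤ (d : ℝ) ^ u * (2 ^ u * M) :=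
                mul_le_mul hc (hlow u huk) (abs_nonneg _) (by positivity)
            _ = (2 * (d : ℝ)) ^ u * M := by rw [mul_pow]; ring
            _ ≤ (2 * (d : ℝ) + 1) ^ (k - 2) * M := by
                refine mul_le_mul_of_nonneg_right ?_ hM0
                calc (2 * (d : ℝ)) ^ u ≤ (2 * (d : ℝ) + 1) ^ u := pow_le_pow_left₀ (by positivity) (by linarith) u
                  _ ≤ (2 * (d : ℝ) + 1) ^ (k - 2) := pow_le_pow_right₀ (by linarith [(Nat.cast_nonneg d : (0:ℝ) ≤ d)]) huk
            _ = M * (2 * (d : ℝ) + 1) ^ (k - 2) := mul_comm _ _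
      _ = ((k - 1 : ℕ) : ℝ) * M * (2 * (d : ℝ) + 1) ^ (k - 2) := by
          rw [Finset.sum_const, Finset.card_range, nsmul_eq_mul]; ring
  have e : ∑ u ∈ range (k - 1), (d.choose u : ℝ) * (fwdDiff (1 : ℝ))^[u] f 0 +
        (d.choose (k - 1) : ℝ) * ((-1) ^ (k - 1) * 2 ^ (k - 1) * ((k - 1).factorial : ℝ))
        - (-1) ^ (k - 1) * 2 ^ (k - 1) * ((k - 1).factorial : ℝ) * (d.choose (k - 1) : ℝ)
      = ∑ u ∈ range (k - 1), (d.choose u : ℝ) * (fwdDiff (1 : ℝ))^[u] f 0 := by ring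
  rw [e]
  simpa [mul_assoc] using hrest

/-- ★★ **AN EXPLICIT DIMENSION THRESHOLD FOR THE SIGN LAW**: for `k ≥ 2` and `d ≥ 2^{k−1}·k·3^{k+1}·(320(2k−3))^k`,
`0 < (−1)^{k−1} · c_k^{(d)}` — i.e. `sgn c_k^{(d)} = (−1)^{k−1}` (main term `2^{k−1}(k−1)!C(d,k−1) ≥ 2^{k−1}(d−k+2)^{k−1} ≥ (2d+1)^{k−1}/2^{k−1}`
against the error `(k−1)·M·(2d+1)^{k−2}`). [cite: JansevanRensburgWhittington2013, §3.2 Theorem 8 (arXiv v4 p. 11)] -/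
theorem sign_largeForceCoeffZd_of_le {k d : ℕ} (hk : 2 ≤ k)
    (hd : 2 ^ (k - 1) * k * (3 ^ (k + 1) * (320 * (2 * (k - 2) + 1)) ^ k) ≤ d) :
    (0 : ℝ) < (-1) ^ (k - 1) * ((largeForceCoeffZd d k : ℤ) : ℝ) := by
  have hmain := abs_largeForceCoeffZd_sub_newton_le hk d
  set M : ℝ := 3 ^ (k + 1) * (320 * (2 * ((k - 2 : ℕ) : ℝ) + 1)) ^ k with hM
  have hM1 : 1 ≤ M := by
    have h1 : (1 : ℝ) ≤ 3 ^ (k + 1) := one_le_pow₀ (by norm_num)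
    have h2 : (1 : ℝ) ≤ (320 * (2 * ((k - 2 : ℕ) : ℝ) + 1)) ^ k := one_le_pow₀ (by
      have : (0 : ℝ) ≤ ((k - 2 : ℕ) : ℝ) := Nat.cast_nonneg _; linarith)
    nlinarith
  -- `d` is huge: in particular `d ≥ 2k` and `2d + 1 ≥ 2^k · k · M`
  have hdR : (2 : ℝ) ^ (k - 1) * k * M ≤ d := by
    have : ((2 ^ (k - 1) * k * (3 ^ (k + 1) * (320 * (2 * (k - 2) + 1)) ^ k) : ℕ) : ℝ) ≤ d := by exact_mod_cast hd
    rw [hM]; push_cast at this ⊢; linarith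
  have hk1 : (1 : ℝ) ≤ ((k - 1 : ℕ) : ℝ) := by exact_mod_cast (show 1 ≤ k - 1 by omega)
  have hkR : ((k - 1 : ℕ) : ℝ) + 1 = k := by
    have : ((k - 1 : ℕ) : ℝ) = (k : ℝ) - 1 := by rw [Nat.cast_sub (by omega)]; simp
    linarith
  have h2k : (2 : ℝ) ^ (k - 1) ≥ 2 := by
    calc (2 : ℝ) ^ (k - 1) ≥ 2 ^ 1 := pow_le_pow_right₀ (by norm_num) (by omega)
      _ = 2 := pow_one 2
  have hd2k : (2 : ℝ) * k ≤ d := by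
    have h1 : (2 : ℝ) * k ≤ 2 ^ (k - 1) * k := mul_le_mul_of_nonneg_right h2k (Nat.cast_nonneg k)
    have h2 : (2 : ℝ) ^ (k - 1) * k ≤ 2 ^ (k - 1) * k * M := le_mul_of_one_le_right (by positivity) hM1
    linarith
  -- lower bound on the main term: `(k−1)!·C(d,k−1) = d(d−1)⋯(d−k+2) ≥ (d−k+2)^{k−1} ≥ ((2d+1)/4)^{k−1}`
  have hkd : k - 1 ≤ d := by
    have : (k : ℝ) ≤ d := by nlinarith [(Nat.cast_nonneg k : (0:ℝ) ≤ k)]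
    have : k ≤ d := by exact_mod_cast this
    omega
  have hdesc : ((d + 1 - (k - 1) : ℕ) : ℝ) ^ (k - 1) ≤ ((k - 1).factorial : ℝ) * (d.choose (k - 1) : ℝ) := by
    have h := Nat.pow_sub_le_descFactorial d (k - 1)
    rw [Nat.descFactorial_eq_factorial_mul_choose] at h
    exact_mod_cast h
  have hbase : (2 * (d : ℝ) + 1) / 4 ≤ ((d + 1 - (k - 1) : ℕ) : ℝ) := by
    rw [Nat.cast_sub (by omega), Nat.cast_sub (by omega)]
    push_cast
    linarith
  have hmainlow : (2 * (d : ℝ) + 1) ^ (k - 1) / 2 ^ (k - 1) ≤ 2 ^ (k - 1) * (((k - 1).factorial : ℝ) * (d.choose (k - 1) : ℝ)) := by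
    have h1 : ((2 * (d : ℝ) + 1) / 4) ^ (k - 1) ≤ ((k - 1).factorial : ℝ) * (d.choose (k - 1) : ℝ) :=
      (pow_le_pow_left₀ (by positivity) hbase _).trans hdesc
    have h4 : ((2 * (d : ℝ) + 1) / 4) ^ (k - 1) = (2 * (d : ℝ) + 1) ^ (k - 1) / 2 ^ (k - 1) / 2 ^ (k - 1) := by
      rw [div_pow, show (4 : ℝ) = 2 * 2 by norm_num, mul_pow, div_div]
    rw [h4, div_le_iff₀ (by positivity)] at h1
    linarith
  -- compare error and main term
  have herr : ((k - 1 : ℕ) : ℝ) * M * (2 * (d : ℝ) + 1) ^ (k - 2) < (2 * (d : ℝ) + 1) ^ (k - 1) / 2 ^ (k - 1) := by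
    rw [lt_div_iff₀ (by positivity)]
    have hpk : (2 * (d : ℝ) + 1) ^ (k - 1) = (2 * (d : ℝ) + 1) ^ (k - 2) * (2 * (d : ℝ) + 1) := by
      rw [← pow_succ]; congr 1; omega
    rw [hpk]
    have hpos : (0 : ℝ) < (2 * (d : ℝ) + 1) ^ (k - 2) := by positivity
    -- `(k−1)·M·2^{k−1} ≤ k·M·2^{k−1} ≤ d < 2d+1`
    have hlt1 : ((k - 1 : ℕ) : ℝ) * M * 2 ^ (k - 1) < 2 * (d : ℝ) + 1 := by nlinarith [hdR, hM1, hkR, h2k]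
    calc ((k - 1 : ℕ) : ℝ) * M * (2 * (d : ℝ) + 1) ^ (k - 2) * 2 ^ (k - 1)
        = (((k - 1 : ℕ) : ℝ) * M * 2 ^ (k - 1)) * (2 * (d : ℝ) + 1) ^ (k - 2) := by ring
      _ < (2 * (d : ℝ) + 1) * (2 * (d : ℝ) + 1) ^ (k - 2) := mul_lt_mul_of_pos_right hlt1 hpos
      _ = (2 * (d : ℝ) + 1) ^ (k - 2) * (2 * (d : ℝ) + 1) := by ring
  -- conclude: with `s = (−1)^{k−1}`, `A = 2^{k−1}(k−1)!C(d,k−1)`: `s·c = A + s(c − sA)` and `|c − sA| < A`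
  have hsq : ((-1 : ℝ) ^ (k - 1)) * (-1) ^ (k - 1) = 1 := by rw [← mul_pow]; norm_num
  have hsabs : |(-1 : ℝ) ^ (k - 1)| = 1 := by rw [abs_pow, abs_neg, abs_one, one_pow]
  have hmain' : |((largeForceCoeffZd d k : ℤ) : ℝ) - (-1) ^ (k - 1) * (2 ^ (k - 1) * (((k - 1).factorial : ℝ) * (d.choose (k - 1) : ℝ)))|
      ≤ ((k - 1 : ℕ) : ℝ) * M * (2 * (d : ℝ) + 1) ^ (k - 2) := by simpa [mul_assoc] using hmain
  have hlt := hmain'.trans_lt (herr.trans_le hmainlow)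
  have h3 : -|((largeForceCoeffZd d k : ℤ) : ℝ) - (-1) ^ (k - 1) * (2 ^ (k - 1) * (((k - 1).factorial : ℝ) * (d.choose (k - 1) : ℝ)))|
      ≤ (-1) ^ (k - 1) * (((largeForceCoeffZd d k : ℤ) : ℝ) - (-1) ^ (k - 1) * (2 ^ (k - 1) * (((k - 1).factorial : ℝ) * (d.choose (k - 1) : ℝ)))) := by
    have := neg_abs_le ((-1 : ℝ) ^ (k - 1) * (((largeForceCoeffZd d k : ℤ) : ℝ)
      - (-1) ^ (k - 1) * (2 ^ (k - 1) * (((k - 1).factorial : ℝ) * (d.choose (k - 1) : ℝ)))))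
    rwa [abs_mul, hsabs, one_mul] at this
  have hid : (-1 : ℝ) ^ (k - 1) * ((largeForceCoeffZd d k : ℤ) : ℝ) = 2 ^ (k - 1) * (((k - 1).factorial : ℝ) * (d.choose (k - 1) : ℝ))
      + (-1) ^ (k - 1) * (((largeForceCoeffZd d k : ℤ) : ℝ) - (-1) ^ (k - 1) * (2 ^ (k - 1) * (((k - 1).factorial : ℝ) * (d.choose (k - 1) : ℝ)))) := by
    linear_combination (2 ^ (k - 1) * (((k - 1).factorial : ℝ) * (d.choose (k - 1) : ℝ))) * hsq
  set A : ℝ := 2 ^ (k - 1) * (((k - 1).factorial : ℝ) * (d.choose (k - 1) : ℝ)) with hA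
  set r : ℝ := ((largeForceCoeffZd d k : ℤ) : ℝ) - (-1) ^ (k - 1) * A with hr
  rw [hid]
  have h4 : |r| < A := hlt
  linarith [h3, h4]

/-- ★★ **EXPLICIT ALTERNATION**: for `k ≥ 2` and `d` beyond both thresholds, `c_k^{(d)} · c_{k+1}^{(d)} < 0` (the signs `(−1)^{k−1}` and `(−1)^k`).
[cite: JansevanRensburgWhittington2013, §3.2 Theorem 8 (arXiv v4 p. 11)] -/
theorem mul_largeForceCoeffZd_succ_neg_of_le {k d : ℕ} (hk : 2 ≤ k)
    (hd : 2 ^ (k - 1) * k * (3 ^ (k + 1) * (320 * (2 * (k - 2) + 1)) ^ k) ≤ d)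
    (hd' : 2 ^ k * (k + 1) * (3 ^ (k + 2) * (320 * (2 * (k - 1) + 1)) ^ (k + 1)) ≤ d) :
    (largeForceCoeffZd d k : ℤ) * largeForceCoeffZd d (k + 1) < 0 := by
  have h1 := sign_largeForceCoeffZd_of_le hk hd
  have h2 := sign_largeForceCoeffZd_of_le (k := k + 1) (d := d) (by omega)
    (by simpa [Nat.add_sub_cancel, show k + 1 + 1 = k + 2 by ring, show k + 1 - 2 = k - 1 by omega] using hd')
  have hsign : ((-1 : ℝ) ^ (k - 1)) * (-1 : ℝ) ^ (k + 1 - 1) = -1 := by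
    rw [show k + 1 - 1 = (k - 1) + 1 by omega, pow_succ, ← mul_assoc, ← mul_pow]; norm_num
  have hprod := mul_pos h1 h2
  have e : (-1 : ℝ) ^ (k - 1) * ((largeForceCoeffZd d k : ℤ) : ℝ) * ((-1) ^ (k + 1 - 1) * ((largeForceCoeffZd d (k + 1) : ℤ) : ℝ))
      = (((-1 : ℝ) ^ (k - 1)) * (-1 : ℝ) ^ (k + 1 - 1)) * (((largeForceCoeffZd d k : ℤ) : ℝ) * ((largeForceCoeffZd d (k + 1) : ℤ) : ℝ)) := by
    ring
  rw [e, hsign] at hprod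
  have : (((largeForceCoeffZd d k : ℤ) : ℝ) * ((largeForceCoeffZd d (k + 1) : ℤ) : ℝ)) < 0 := by linarith
  exact_mod_cast this

end Literature.Probability.RandomPlanarGeometry.SAW.Zd
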